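import Summits.Ventures.CertifiedManyBodySolver.Observables.MeanFieldClassExclusionObjectE
import Literature.MathematicalPhysics.QuantumLattice.HubbardFermiSeaTangentRows
import Literature.MathematicalPhysics.QuantumLattice.HubbardFermiSeaTangentRowsDeepColumns
import HarnessLib

/-!
# Ventures/CertifiedManyBodySolver — Observables/MeanFieldClassExclusionObjectETl2201.lean

HONEST FRAMING: first certified bounds; not a superconductivity verdict; every number certified or labelled float.
A competing-order EXCLUSION removes a named class of candidate ground states; it never says which order is present;
no phase sentence follows.

Cell `hubbard-tc` (MO-S3, D-0096), seat `hubbard-tc-mod-3` (G3: competing orders as exclusion inputs from certified energy ORDERINGS),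
`prover-hubbard-tc-mod-3-g5-0`. MF/BCS-class words for the HOLD-OUT #56 = **Tl₂Ba₂CuO₆₊δ (Tl-2201, VSET #34a/b/c)** on its S1 object-E box
(`BOXES/Tl2Ba2CuO6.md` run-4 v1.3: `t′/t_eff ∈ [−0.425, −0.324]`, `U/t_eff ∈ [3.19, 8.20]`; fillings 34a optimally doped `n ∈ [0.80, 0.88]`,
34b overdoped `p = 0.26` `n ∈ [0.70, 0.78]`, 34c non-SC end member `n ∈ [0.635, 0.715]`; G2 blind bands M34a/b/c, TC-TABLE v0.7.57). For every torus
limit `ω` of unit `(rectN n L, S^z = 0)`-sector ground states of `hubbardTorusTT' L 1 t′ U`, `Re ω(n_{0↑} n_{0↓}) < (n/2)²` (no non-magnetic HF /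
singlet-BCS ground state — Wick; the identification is the docstring's reading, the THEOREM is the strict docc inequality) on:

* 34a (`n ∈ [4/5, 22/25]`): EVERY `U ≥ 6.25` (`tlE_opt_docc_lt_of`, cond. #445 ∧ #473 ∧ #472; exact margin `+0.0327`) — covers `[6.25, 8.20]` of the box;
* 34b (`n ∈ [7/10, 39/50]`): EVERY `U ≥ 7.5` (`tlE_od26_docc_lt_of`, cond. #445 ∧ #473; `+0.0213`) — covers `[7.5, 8.20]`;
* 34c (`n ∈ [0.635, 0.715]`): NO word — the threshold of these devices lies above the box top `8.20` (exact `−0.050` at `U₁ = 8` with the vacuum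
  chord; `≈ −0.007` with the `1/2 → 7/8` chord of the transported #498 cap; not filed).
Below the thresholds the strips are «undetermined-MF» (the transported caps are too weak at low `U`, as for every deep-`t′` column).

Devices (all tree theorems of `MeanFieldClassExclusionObjectE.lean`): CAP at `U = 8` on `t′ ≤ −1/4` = the `t′`-CHORD cap `objE_conc78_cap8`
(`e(1, s, 8, 7/8) ≤ −0.8372323499 − 0.6023622600·s`, CERTIFIED #473 floor ∧ #445 cap), read DOWN in density by the vacuum chord (`objE_lowBand_cap8`,
`n ≤ 7/8`) or UP by the density chord to the #472 half-filling cap (`objE_highBand_cap8`, `7/8 < n`); FLOOR at `U₀ = 0` = kernel tangent Fermi-sea rows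
on the columns `t′ ∈ {−9/20, −2/5, −7/20, −3/10}` (`HubbardFermiSeaTangentRowsDeepColumns` / `…TangentRows`; touch `3/4` for 34b, `4/5 | 21/25` and `7/8`
for 34a) read between columns by concavity (`objE_floor_between`); TAIL = `doccN_lt_of_cap8_threshold` (`U₁ ≤ 8`; `(n/2)²` above its tangent at the lower
band edge; every leaf LINEAR). Exact designer: `hubbard-tc-mod-3/g5-replay/tl/tl_design.py` (tree constants parsed from the row files).
Conditional on the named claim nodes BY HYPOTHESIS. WHAT THIS IS NOT: a statement about Tl-2201's overdoped physics, stripes, d-wave order or T_c;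
the saturated-FM class; tight; a phase word.

References: T. Koma, H. Tasaki, J. Stat. Phys. 76 (1994) 745, §1 [KomaTasaki1994]; V. Bach, E. H. Lieb, J. P. Solovej, J. Stat. Phys. 76 (1994) 3,
eq. (2c.36) [BachLiebSolovej1994]; E. H. Lieb, M. Loss, Duke Math. J. 71 (1993) 337, §8 Thm 8.2 [LiebLoss1993]; R. B. Israel, Convexity in the
Theory of Lattice Gases (1979), Thm I.3.4 [Israel1979]; D. Ruelle, Statistical Mechanics (1969) §3.3 [Ruelle1969].
-/

noncomputable section

namespace Summit.Ventures.CertifiedManyBodySolver.Observables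

open Literature.MathematicalPhysics.QuantumLattice
open Literature.MathematicalPhysics.QuantumLattice.ThermodynamicLimit
open Summit.Ventures.CertifiedManyBodySolver.Certificates
open Matrix HubbardWave0 Literature.Probability.LatticeModels Filter Topology
open scoped ComplexOrder BigOperators

/-- **Tl₂Ba₂CuO₆₊δ optimally doped (VSET 34a), object-E face `t′ ∈ [−17/40, −8/25]` × `n ∈ [4/5, 22/25]` — MF/BCS class excluded at EVERY `U ≥ 6.25`**
(covers `[6.25, 8.20]` of the box `U/t_eff ∈ [3.19, 8.20]`): assume the claim nodes #445, #473, #472; then every GS torus limit has `Re ω(n_{0↑}n_{0↓}) < (n/2)²`.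
Cap = `t′`-chord cap at `(8, 7/8)` read down (vacuum chord, `n ≤ 7/8`) or up (density chord to #472, `n > 7/8`); floor = tangent rows (touch `4/5 | 21/25`, and
`7/8` for the high band) on the columns `−9/20, −2/5, −7/20, −3/10`; three `t′`-pieces; smallest exact margin `+0.0327`.
[cite: KomaTasaki1994, §1] [cite: BachLiebSolovej1994, eq. (2c.36)] [cite: LiebLoss1993, §8, Theorem 8.2] -/
theorem tlE_opt_docc_lt_of (h445 : cert_dbt329pair_allk)
    (h473 : cert_r473_bs_M3U8tp0_w3_b4_R2_ob5p2_kry1_kry2c3rel_hanK7B4D4_KN4_PR20d4_hanK8c2s_hanK8B4D4_uprime)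
    (h472 : cert_r472_pb2_tl_upper_n1_U8)
    {t' U n : ℝ} (ht1 : -17 / 40 ≤ t') (ht2 : t' ≤ -8 / 25) (hU : 25 / 4 ≤ U)
    (hn1 : 4 / 5 ≤ n) (hn2 : n ≤ 22 / 25) :
    ∀ (ω : InfVolFermionState 2) (Ls : ℕ → ℕ) (ψ : ∀ L, Fock (Orb (FermionTorus 2 L))),
      Tendsto Ls atTop atTop →
      (∀ j, IsGroundStateInSector (hubbardTorusTT' (Ls j) 1 t' U) (rectN n (Ls j)) 0 (ψ (Ls j))) →
      (∀ j, star (ψ (Ls j)) ⬝ᵥ ψ (Ls j) = 1) → ω.IsTorusLimitOf ψ Ls →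
      (ω.expect ({0} : Finset (Site 2))
        (nAt 0 (Finset.mem_singleton_self 0) 0 * nAt 0 (Finset.mem_singleton_self 0) 1)).re < (n / 2) ^ 2 := by
  have hn0 : (0 : ℝ) ≤ n := by linarith
  have hn2' : n < 2 := by linarith
  have hnpos : (0 : ℝ) < n := by linarith
  -- the class constant `(n/2)²` above its tangent at `n = 4/5`, scaled by the threshold `U₁ = 25/4`
  have hsq : (-4 / 25 : ℝ) + 2 / 5 * n ≤ (n / 2) ^ 2 := by nlinarith [sq_nonneg (n - 4 / 5)]
  have hsqU : ((-4 / 25 : ℝ) + 2 / 5 * n) * (25 / 4) ≤ (n / 2) ^ 2 * (25 / 4) :=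
    mul_le_mul_of_nonneg_right hsq (by norm_num)
  have hC8 := objE_halfFilling_cap8 h472 t'
  have hR := objE_conc78_cap8 h445 h473 (s := t') (by linarith)
  have hBs : (0 : ℝ) ≤ -0.6023622600 * t' := mul_nonneg_of_nonpos_of_nonpos (by norm_num) (by linarith)
  -- low-band rows (touch 4/5 or 21/25) and high-band rows (touch 7/8) on the four columns
  have la := fermiSeaTangentRow_tPrime_neg_nine_div_twenty_at_four_div_five (U := 0) le_rfl hn0 hn2'
  have lb := fermiSeaTangentRow_tPrime_neg_two_div_five_at_twentyone_div_twentyfive (U := 0) le_rfl hn0 hn2'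
  have lc := fermiSeaTangentRow_tPrime_neg_seven_div_twenty_at_four_div_five (U := 0) le_rfl hn0 hn2'
  have ld := fermiSeaTangentRow_tPrime_neg_three_div_ten_at_twentyone_div_twentyfive (U := 0) le_rfl hn0 hn2'
  have ua := fermiSeaTangentRow_tPrime_neg_nine_div_twenty_at_seven_div_eight (U := 0) le_rfl hn0 hn2'
  have ub := fermiSeaTangentRow_tPrime_neg_two_div_five_at_seven_div_eight (U := 0) le_rfl hn0 hn2'
  have uc := fermiSeaTangentRow_tPrime_neg_seven_div_twenty_at_seven_div_eight (U := 0) le_rfl hn0 hn2'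
  have ud := fermiSeaTangentRow_tPrime_neg_three_div_ten_at_seven_div_eight (U := 0) le_rfl hn0 hn2'
  rcases le_or_gt n (7 / 8) with hb | hb
  · -- low band `n ≤ 7/8`: vacuum chord of the t′-chord cap
    have hcap := objE_lowBand_cap8 hR hBs hnpos hb le_rfl
    rcases le_or_gt t' (-2 / 5) with hp | hp
    · have hfl := objE_floor_between hn0 hn2' (by norm_num : (-9 / 20 : ℝ) ≤ -2 / 5) la lb (by linarith) hp
      exact doccN_lt_of_cap8_threshold (U₁ := 25 / 4) (by norm_num) (by norm_num) hU hn0 hn2' hcap hfl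
        (sub_min_lt_of (by linarith) (by linarith))
    rcases le_or_gt t' (-7 / 20) with hq | hq
    · have hfl := objE_floor_between hn0 hn2' (by norm_num : (-2 / 5 : ℝ) ≤ -7 / 20) lb lc hp.le hq
      exact doccN_lt_of_cap8_threshold (U₁ := 25 / 4) (by norm_num) (by norm_num) hU hn0 hn2' hcap hfl
        (sub_min_lt_of (by linarith) (by linarith))
    · have hfl := objE_floor_between hn0 hn2' (by norm_num : (-7 / 20 : ℝ) ≤ -3 / 10) lc ld hq.le (by linarith)
      exact doccN_lt_of_cap8_threshold (U₁ := 25 / 4) (by norm_num) (by norm_num) hU hn0 hn2' hcap hfl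
        (sub_min_lt_of (by linarith) (by linarith))
  · -- high band `7/8 < n ≤ 22/25`: density chord to the half-filling cap
    have hcap := objE_highBand_cap8 hR hC8 hBs (m := 7 / 8) hb.le hb (by linarith)
    rcases le_or_gt t' (-2 / 5) with hp | hp
    · have hfl := objE_floor_between hn0 hn2' (by norm_num : (-9 / 20 : ℝ) ≤ -2 / 5) ua ub (by linarith) hp
      exact doccN_lt_of_cap8_threshold (U₁ := 25 / 4) (by norm_num) (by norm_num) hU hn0 hn2' hcap hfl
        (sub_min_lt_of (by linarith) (by linarith))
    rcases le_or_gt t' (-7 / 20) with hq | hq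
    · have hfl := objE_floor_between hn0 hn2' (by norm_num : (-2 / 5 : ℝ) ≤ -7 / 20) ub uc hp.le hq
      exact doccN_lt_of_cap8_threshold (U₁ := 25 / 4) (by norm_num) (by norm_num) hU hn0 hn2' hcap hfl
        (sub_min_lt_of (by linarith) (by linarith))
    · have hfl := objE_floor_between hn0 hn2' (by norm_num : (-7 / 20 : ℝ) ≤ -3 / 10) uc ud hq.le (by linarith)
      exact doccN_lt_of_cap8_threshold (U₁ := 25 / 4) (by norm_num) (by norm_num) hU hn0 hn2' hcap hfl
        (sub_min_lt_of (by linarith) (by linarith))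

/-- **Tl₂Ba₂CuO₆₊δ overdoped `p = 0.26` (VSET 34b, T_c ≈ 25 K crystal), object-E face `t′ ∈ [−17/40, −8/25]` × `n ∈ [7/10, 39/50]` — MF/BCS class
excluded at EVERY `U ≥ 7.5`** (covers `[7.5, 8.20]` of the box): assume #445, #473; then every GS torus limit has `Re ω(n_{0↑}n_{0↓}) < (n/2)²`. Cap = vacuum chord
of the `t′`-chord cap at `(8, 7/8)`; floor = tangent rows touching at `3/4` on the columns `−9/20, −2/5, −7/20, −3/10`; smallest exact margin `+0.0213`.
[cite: KomaTasaki1994, §1] [cite: BachLiebSolovej1994, eq. (2c.36)] [cite: LiebLoss1993, §8, Theorem 8.2] -/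
theorem tlE_od26_docc_lt_of (h445 : cert_dbt329pair_allk)
    (h473 : cert_r473_bs_M3U8tp0_w3_b4_R2_ob5p2_kry1_kry2c3rel_hanK7B4D4_KN4_PR20d4_hanK8c2s_hanK8B4D4_uprime)
    {t' U n : ℝ} (ht1 : -17 / 40 ≤ t') (ht2 : t' ≤ -8 / 25) (hU : 15 / 2 ≤ U)
    (hn1 : 7 / 10 ≤ n) (hn2 : n ≤ 39 / 50) :
    ∀ (ω : InfVolFermionState 2) (Ls : ℕ → ℕ) (ψ : ∀ L, Fock (Orb (FermionTorus 2 L))),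
      Tendsto Ls atTop atTop →
      (∀ j, IsGroundStateInSector (hubbardTorusTT' (Ls j) 1 t' U) (rectN n (Ls j)) 0 (ψ (Ls j))) →
      (∀ j, star (ψ (Ls j)) ⬝ᵥ ψ (Ls j) = 1) → ω.IsTorusLimitOf ψ Ls →
      (ω.expect ({0} : Finset (Site 2))
        (nAt 0 (Finset.mem_singleton_self 0) 0 * nAt 0 (Finset.mem_singleton_self 0) 1)).re < (n / 2) ^ 2 := by
  have hn0 : (0 : ℝ) ≤ n := by linarith
  have hn2' : n < 2 := by linarith
  have hnpos : (0 : ℝ) < n := by linarith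
  -- the class constant `(n/2)²` above its tangent at `n = 7/10`, scaled by the threshold `U₁ = 15/2`
  have hsq : (-49 / 400 : ℝ) + 7 / 20 * n ≤ (n / 2) ^ 2 := by nlinarith [sq_nonneg (n - 7 / 10)]
  have hsqU : ((-49 / 400 : ℝ) + 7 / 20 * n) * (15 / 2) ≤ (n / 2) ^ 2 * (15 / 2) :=
    mul_le_mul_of_nonneg_right hsq (by norm_num)
  have hR := objE_conc78_cap8 h445 h473 (s := t') (by linarith)
  have hBs : (0 : ℝ) ≤ -0.6023622600 * t' := mul_nonneg_of_nonpos_of_nonpos (by norm_num) (by linarith)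
  have hcap := objE_lowBand_cap8 hR hBs hnpos hn2 (by norm_num)
  have ra := fermiSeaTangentRow_tPrime_neg_nine_div_twenty_at_three_div_four (U := 0) le_rfl hn0 hn2'
  have rb := fermiSeaTangentRow_tPrime_neg_two_div_five_at_three_div_four (U := 0) le_rfl hn0 hn2'
  have rc := fermiSeaTangentRow_tPrime_neg_seven_div_twenty_at_three_div_four (U := 0) le_rfl hn0 hn2'
  have rd := fermiSeaTangentRow_tPrime_neg_three_div_ten_at_three_div_four (U := 0) le_rfl hn0 hn2'
  rcases le_or_gt t' (-2 / 5) with hp | hp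
  · have hfl := objE_floor_between hn0 hn2' (by norm_num : (-9 / 20 : ℝ) ≤ -2 / 5) ra rb (by linarith) hp
    exact doccN_lt_of_cap8_threshold (U₁ := 15 / 2) (by norm_num) (by norm_num) hU hn0 hn2' hcap hfl
      (sub_min_lt_of (by linarith) (by linarith))
  rcases le_or_gt t' (-7 / 20) with hq | hq
  · have hfl := objE_floor_between hn0 hn2' (by norm_num : (-2 / 5 : ℝ) ≤ -7 / 20) rb rc hp.le hq
    exact doccN_lt_of_cap8_threshold (U₁ := 15 / 2) (by norm_num) (by norm_num) hU hn0 hn2' hcap hfl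
      (sub_min_lt_of (by linarith) (by linarith))
  · have hfl := objE_floor_between hn0 hn2' (by norm_num : (-7 / 20 : ℝ) ≤ -3 / 10) rc rd hq.le (by linarith)
    exact doccN_lt_of_cap8_threshold (U₁ := 15 / 2) (by norm_num) (by norm_num) hU hn0 hn2' hcap hfl
      (sub_min_lt_of (by linarith) (by linarith))

end Summit.Ventures.CertifiedManyBodySolver.Observables

end
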